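import Literature.NumberTheory.EllipticCurves.BSDInvariants
import Mathlib.Analysis.Calculus.Deriv.Star
import HarnessLib

/-!
# Discharges of named facts of `BSDInvariants.lean`: the leading Taylor coefficient is real

Sibling file of `Literature.NumberTheory.EllipticCurves.BSDInvariants` (D-0014 keeps `Literature/`
sorry-free by stating cited results as named facts `def X : Prop`; a discharge is a
`theorem X_holds : X`). Proved here:

* `WeierstrassCurve.leadingLCoeff_im_eq_zero_holds`, discharging
  `WeierstrassCurve.leadingLCoeff_im_eq_zero`: for an elliptic curve `E/ℚ` the leading Taylor
  coefficient `L^{(r)}(E,1)/r!` (`WeierstrassCurve.leadingLCoeff`, `r = r_an`) is a real number.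
* `WeierstrassCurve.bsdLeadingTermFormula_iff_re_holds`, discharging
  `WeierstrassCurve.bsdLeadingTermFormula_iff_re`: consequently the BSD leading-term clause
  `W.BSDLeadingTermFormula` (`L^{(r)}(E,1)/r! = W.bsdRHS` in `ℂ`) is equivalent to the identity of
  real numbers `(W.leadingLCoeff).re = W.bsdRHS` — the form in which the formula is printed
  (Wiles, Clay text, §1, Remark 1: `L*(C,s) ∼ c*(s-1)^r`, `c* = |Ш_C| R_∞ w_∞ ∏ w_p / |C(ℚ)_tors|²`,
  a real number).

The printed input is the **definition** of the `L`-series (Silverman, *AEC*, App. C §16, p. 449):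
`L_{E/K}(s) = ∏_{v ∈ M_K^0} L_v(q_v^{-s})^{-1}` with `L_v(T) ∈ ℤ[T]`, so that the Dirichlet
coefficients `aₙ` of `L_{E/K}(s) = ∑ aₙ n^{-s}` are integers (in the tree: Mathlib's
`WeierstrassCurve.LFunction W : ArithmeticFunction ℤ` and
`WeierstrassCurve.LSeries W s = LSeries (↑ ∘ W.LFunction) s`). Everything else is the reflection
principle, proved here in full and **unconditionally** (no modularity / analytic continuation is
assumed):

1. `WeierstrassCurve.LSeries_conj`: `L(W, s̄) = conj L(W, s)` for *every* `s ∈ ℂ` — complex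
   conjugation is a homeomorphism of `ℂ`, so it commutes with `tsum` whether or not the series
   converges (`Complex.conj_tsum`), and `conj (aₙ n^{-s}) = aₙ n^{-s̄}` for `aₙ ∈ ℤ`;
2. `WeierstrassCurve.entireLFunction_conj`: the same identity for the tree's entire `L`-function
   `WeierstrassCurve.entireLFunction` (`AnalyticRank.lean`), in *both* branches of its definition:
   if an entire continuation `F` exists, `s ↦ conj F(s̄)` is again one
   (`DifferentiableAt.conj_conj` and 1.), hence equals `F` by uniqueness of the continuation
   (`WeierstrassCurve.subsingleton_entireContinuations`, the identity theorem); if none exists,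
   `entireLFunction = LSeries` and 1. applies verbatim. (The conditional form, under
   `W.HasEntireLFunction`, is also available as `WeierstrassCurve.conj_entireLFunction` in
   `ComplexMultiplicationBurungaleFlachCorOneProofs`; the present file avoids that import chain
   and removes the hypothesis.)
3. `WeierstrassCurve.iteratedDeriv_entireLFunction_conj`: reflection symmetry passes to all
   iterated derivatives (Mathlib's unconditional `deriv_conj_conj`, by induction on the order);
4. at the real point `s = 1` every `L^{(n)}(W,1)` is therefore real, and so is
   `L^{(r)}(W,1)/r!` (`WeierstrassCurve.conj_leadingLCoeff`, `leadingLCoeff_im_eq_zero_holds`).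

Steps 1–3 hold for every Weierstrass curve over every number field; step 4 is recorded over a
number field as `conj_leadingLCoeff` / `leadingLCoeff_im` and specialised to the named fact over
`ℚ`. As for the other `Rat`-section facts of `BSDInvariants.lean`, the named fact is a `def` over
every `W : WeierstrassCurve ℚ` (the section instance `[W.IsElliptic]` of `BSDInvariants.lean` does
not enter a `def` whose body does not use it) and it is discharged for every such `W`: the proof
uses neither `IsElliptic` nor the existence of an analytic continuation.

## References

* J. H. Silverman, *The Arithmetic of Elliptic Curves*, 2nd ed., GTM 106 (2009), App. C §16,
  Definition of `L_{E/K}(s)` and the local factors `L_v(T) ∈ ℤ[T]` (p. 449; PDF p. 390);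
  Conj. C.16.5 (p. 451; PDF p. 392) for the quantity `lim_{s→1} L_E(s)/(s-1)^r`.
* A. Wiles, *The Birch and Swinnerton-Dyer conjecture*, in *The Millennium Prize Problems*, Clay
  Mathematics Institute / AMS (2006), 31–41, §1, Conjecture and Remark 1 (PDF p. 2): the refined
  formula `c* = |Ш_C| R_∞ w_∞ ∏_{p ∣ 2Δ} w_p / |C(ℚ)_tors|²` (bib key `Wiles2000`).
-/

noncomputable section

open scoped Classical ComplexConjugate

open Complex

namespace WeierstrassCurve

section NumberField

variable {K : Type*} [Field K] [NumberField K] (W : WeierstrassCurve K)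

/-- **The `L`-series of a Weierstrass curve commutes with complex conjugation**:
`L(W, s̄) = conj L(W, s)` for every `s ∈ ℂ` (including the region where the Dirichlet series
diverges and `LSeries` takes its junk value, since `conj` is a homeomorphism commuting with
`tsum`). The input is that the Dirichlet coefficients are integers: `L_{E/K}(s) = ∏_v L_v(q_v^{-s})⁻¹`
with `L_v(T) ∈ ℤ[T]` (Silverman, *AEC*, App. C §16, Definition, p. 449; Mathlib's
`WeierstrassCurve.LFunction : ArithmeticFunction ℤ`).
[cite: SilvermanAEC2009, App. C §16, Definition of L_{E/K} (p. 449; PDF p. 390)] -/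
theorem LSeries_conj (s : ℂ) : W.LSeries (conj s) = conj (W.LSeries s) := by
  simp only [WeierstrassCurve.LSeries, LSeries]
  rw [Complex.conj_tsum]
  refine tsum_congr fun n => ?_
  rcases Nat.eq_zero_or_pos n with rfl | hn
  · simp [LSeries.term]
  · rw [LSeries.term_of_ne_zero hn.ne', LSeries.term_of_ne_zero hn.ne', map_div₀]
    simp only [Function.comp_apply, map_intCast]
    congr 1
    have harg : ((n : ℂ)).arg ≠ Real.pi := by
      rw [Complex.natCast_arg]
      exact Real.pi_pos.ne
    have h := Complex.conj_cpow (n : ℂ) (conj s) harg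
    rw [Complex.conj_conj, map_natCast] at h
    exact h

/-- **Reflection principle for the entire `L`-function, unconditionally**:
`L(W, s̄) = conj L(W, s)` for the tree's `WeierstrassCurve.entireLFunction` and every `s ∈ ℂ`.
If `L(W,s)` admits an entire continuation `F`, then `s ↦ conj F(s̄)` is entire
(`DifferentiableAt.conj_conj`) and agrees with the `L`-series on `Re s > 3/2` (`LSeries_conj`),
so it *is* `F` by uniqueness of the continuation (`subsingleton_entireContinuations`, identity
theorem); if not, `entireLFunction W = W.LSeries` by definition and `LSeries_conj` applies.
Integer coefficients: Silverman, *AEC*, App. C §16, Definition (p. 449).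
[cite: SilvermanAEC2009, App. C §16, Definition of L_{E/K} (p. 449; PDF p. 390)] -/
theorem entireLFunction_conj (s : ℂ) :
    W.entireLFunction (conj s) = conj (W.entireLFunction s) := by
  by_cases h : W.HasEntireLFunction
  · set g : ℂ → ℂ := fun z => conj (W.entireLFunction (conj z)) with hg
    have hgmem : g ∈ W.entireContinuations := by
      refine ⟨?_, ?_⟩
      · intro z
        have hd : DifferentiableAt ℂ W.entireLFunction (conj z) :=
          (W.differentiable_entireLFunction h) _
        have h2 := hd.conj_conj
        rw [Complex.conj_conj] at h2
        exact h2
      · intro z hz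
        have hz' : (3 / 2 : ℝ) < (conj z).re := by rwa [conj_re]
        show conj (W.entireLFunction (conj z)) = W.LSeries z
        rw [W.entireLFunction_eq_LSeries h hz', W.LSeries_conj, Complex.conj_conj]
    have heq : g = W.entireLFunction :=
      W.subsingleton_entireContinuations hgmem (W.entireLFunction_mem h)
    have := congrFun heq (conj s)
    simp only [hg, Complex.conj_conj] at this
    exact this.symm
  · have hL : W.entireLFunction = W.LSeries := by
      unfold entireLFunction
      rw [dif_neg]
      exact h
    rw [hL]
    exact W.LSeries_conj s

/-- Reflection symmetry passes to all derivatives: if `f (s̄) = conj f(s)` for all `s`, then the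
same holds for every iterated derivative `f^{(n)}` (Mathlib's unconditional `deriv_conj_conj`,
by induction on `n`; junk values of `deriv` included). [folklore] -/
private theorem iteratedDeriv_conj_of_conj {f : ℂ → ℂ} (hf : ∀ s, f (conj s) = conj (f s))
    (n : ℕ) (s : ℂ) : iteratedDeriv n f (conj s) = conj (iteratedDeriv n f s) := by
  induction n generalizing s with
  | zero => simpa using hf s
  | succ n ih =>
    have hfun : (conj ∘ iteratedDeriv n f ∘ conj : ℂ → ℂ) = iteratedDeriv n f := by
      funext t
      simp only [Function.comp_apply, ih t, Complex.conj_conj]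
    have key : deriv (iteratedDeriv n f) = conj ∘ deriv (iteratedDeriv n f) ∘ conj := by
      have := deriv_conj_conj (f := iteratedDeriv n f)
      rwa [hfun] at this
    rw [iteratedDeriv_succ]
    have := congrFun key (conj s)
    simpa [Complex.conj_conj] using this

/-- All iterated derivatives of the entire `L`-function satisfy the reflection principle:
`L^{(n)}(W, s̄) = conj L^{(n)}(W, s)`. [folklore] -/
theorem iteratedDeriv_entireLFunction_conj (n : ℕ) (s : ℂ) :
    iteratedDeriv n W.entireLFunction (conj s) = conj (iteratedDeriv n W.entireLFunction s) :=
  iteratedDeriv_conj_of_conj W.entireLFunction_conj n s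

/-- In particular every derivative `L^{(n)}(W, x)` at a real point `x` is real. [folklore] -/
theorem iteratedDeriv_entireLFunction_ofReal_im (n : ℕ) (x : ℝ) :
    (iteratedDeriv n W.entireLFunction x).im = 0 := by
  have h := W.iteratedDeriv_entireLFunction_conj n x
  rw [Complex.conj_ofReal] at h
  exact Complex.conj_eq_iff_im.1 h.symm

/-- The leading Taylor coefficient `L^{(r)}(W,1)/r!` is invariant under complex conjugation.
[folklore] -/
theorem conj_leadingLCoeff : conj W.leadingLCoeff = W.leadingLCoeff := by
  unfold leadingLCoeff
  rw [map_div₀, map_natCast]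
  congr 1
  have h := W.iteratedDeriv_entireLFunction_conj W.analyticRank 1
  rw [map_one] at h
  exact h.symm

/-- The leading Taylor coefficient `L^{(r)}(W,1)/r!` of a Weierstrass curve over a number field
is real (reflection principle, from the integrality of the Dirichlet coefficients,
Silverman, *AEC*, App. C §16, Definition, p. 449).
[cite: SilvermanAEC2009, App. C §16, Definition of L_{E/K} (p. 449; PDF p. 390)] -/
theorem leadingLCoeff_im (W : WeierstrassCurve K) : (W.leadingLCoeff).im = 0 :=
  Complex.conj_eq_iff_im.1 W.conj_leadingLCoeff

end NumberField

section Rat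

variable (W : WeierstrassCurve ℚ)

/-- **Discharge of the named fact `WeierstrassCurve.leadingLCoeff_im_eq_zero`**
(`BSDInvariants.lean`): for an elliptic curve `E/ℚ` the leading Taylor coefficient
`L^{(r)}(E,1)/r!` at `s = 1` (`r = r_an`; the left-hand side of the Birch–Swinnerton-Dyer
formula, Silverman, *AEC*, Conj. C.16.5(b)) is a real number. Printed input: the Euler factors
`L_v(T) ∈ ℤ[T]` of `L_{E/K}(s) = ∏_v L_v(q_v^{-s})⁻¹` (Silverman, *AEC*, App. C §16, Definition,
p. 449), i.e. integer Dirichlet coefficients; whence `L(E, s̄) = conj L(E, s)` for the series and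
— by uniqueness of the entire continuation — for `W.entireLFunction` (`entireLFunction_conj`,
unconditional), then for all its derivatives (`iteratedDeriv_entireLFunction_conj`), so the Taylor
coefficients at the real point `s = 1` are real (`leadingLCoeff_im`).
[cite: SilvermanAEC2009, App. C §16, Definition of L_{E/K} (p. 449; PDF p. 390) and Conj. C.16.5 (p. 451; PDF p. 392)] -/
theorem leadingLCoeff_im_eq_zero_holds : W.leadingLCoeff_im_eq_zero :=
  W.leadingLCoeff_im

/-- **Discharge of the named fact `WeierstrassCurve.bsdLeadingTermFormula_iff_re`**
(`BSDInvariants.lean`): the BSD leading-term clause `W.BSDLeadingTermFormula`, stated in the tree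
as the identity `W.leadingLCoeff = (W.bsdRHS : ℂ)` of complex numbers, is equivalent to the
identity of real numbers `(W.leadingLCoeff).re = W.bsdRHS`. This is the form in which the refined
conjecture is printed — Wiles, Clay text, §1, Remark 1: "`L*(C, s) ∼ c*(s − 1)^r` with
`c* = |Ш_C| R_∞ w_∞ ∏_{p∣2Δ} w_p / |C(ℚ)_tors|²`", a real number (likewise Silverman, *AEC*,
Conj. C.16.5(b)). Proof: the leading Taylor coefficient `L^{(r)}(E,1)/r!` is real
(`leadingLCoeff_im_eq_zero_holds`, reflection principle from the integer Dirichlet coefficients,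
Silverman, *AEC*, App. C §16, Definition of `L_{E/K}`), and a complex number with vanishing
imaginary part equals `(x : ℂ)`, `x : ℝ`, iff its real part equals `x` (`Complex.ext`). Like
`leadingLCoeff_im_eq_zero_holds` it holds for every `W : WeierstrassCurve ℚ` (no `IsElliptic`,
no analytic continuation assumed).
[cite: Wiles2000, §1, Conjecture and Remark 1 (PDF p. 2)]
[cite: SilvermanAEC2009, App. C §16, Definition of L_{E/K} (p. 449) and Conj. C.16.5 (p. 451)] -/
theorem bsdLeadingTermFormula_iff_re_holds : W.bsdLeadingTermFormula_iff_re := by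
  have him : (W.leadingLCoeff).im = 0 := W.leadingLCoeff_im_eq_zero_holds
  unfold bsdLeadingTermFormula_iff_re BSDLeadingTermFormula
  constructor
  · intro h
    rw [h, Complex.ofReal_re]
  · intro h
    exact Complex.ext (by rw [h, Complex.ofReal_re]) (by rw [him, Complex.ofReal_im])

end Rat

end WeierstrassCurve

end
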